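import Summits.Parity.GeneralizedHardyLittlewood.Theorems.FordMaynardNoSieveConst0164NegWitness0164J3

/-!
# Route `FordMaynardNoSieveConst0164`, crux `NegWitness0164` (stmt-Parity-19102), line `birth`,
# stub `stub_tweakNeg0164`: `J₃` as an explicit one-dimensional logarithmic integral

Helper file toward the certificate stub (K. Ford, J. Maynard, *On the theory of prime producing sieves*,
arXiv:2407.14368, §8: "`I₃ = -2 ∫_ν^{1/3} log((1-x)/max(x, 1/2-x) - 1)/(x(1-x)) dx`").  With `…J3` and `…LogKernel`:

* `volume_coord_eq_zero_fin_one` — `{u : ℝ¹ | u₀ = c}` is null; `K3_eq_window_lower_0164` — on `Δ₂(w)` with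
  `2ν < w ≤ 1/2 + ν` the kernel `𝟙[ν ≤ vᵢ < 1/2]/(v₀v₁)` and the open-window kernel `𝟙[ν < v₀ < w-ν]/(v₀v₁)` have the
  same slice integral (they differ on `{v₀ ∈ {ν, w-ν}}`);
* `K3_closed_form_0164` — hence `K(w) = ∫_{Δ₂(w)} 𝟙[ν ≤ vᵢ < 1/2]/(v₀v₁)` in closed form on both ranges of `w ∈ (1/2, 1]`;
* `J3_eq_integral_log_0164` — **`J₃ = ∫_{t ∈ (0,1]} 𝟙[ν ≤ t < 1/2] Φ(t)/t dt`** with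
  `Φ(t) = (log((1/2)/(1/2-t)) − log((1/2-t)/(1/2)))/(1-t)` for `t ≤ 1/2 - ν` and
  `Φ(t) = (log((1-t-ν)/ν) − log(ν/(1-t-ν)))/(1-t)` for `t > 1/2 - ν` (`ν = 41/250`) — inequality (I) of
  `stub_tweakNeg0164_of_table` is now about a one-dimensional integral of an explicit elementary function.

Def-free.  References: [FordMaynard2024PrimeSieves] arXiv:2407.14368, §8 (I₃).
-/

noncomputable section

open Finset MeasureTheory Set
open scoped Classical
open Literature.NumberTheory.Sieve Literature.NumberTheory.Sieve.FordMaynard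

namespace Summit.Parity.GeneralizedHardyLittlewood.FordMaynardNoSieveConst0164NegWitness0164

/-- A coordinate hyperplane `{u | u₀ = c}` of `ℝ¹` is a null set. [folklore] -/
theorem volume_coord_eq_zero_fin_one (c : ℝ) : volume {u : Fin 1 → ℝ | u 0 = c} = 0 := by
  have h : {u : Fin 1 → ℝ | u 0 = c} = (MeasurableEquiv.funUnique (Fin 1) ℝ) ⁻¹' {c} := by
    ext u
    simp only [Set.mem_setOf_eq, Set.mem_preimage, Set.mem_singleton_iff]
    exact Iff.rfl
  rw [h]
  exact ((volume_preserving_funUnique (Fin 1) ℝ).measure_preimage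
    (measurableSet_singleton c).nullMeasurableSet).trans Real.volume_singleton

/-- **The closed and the open window have the same slice integral** (they differ on a null set): for
`w ≤ 1/2 + ν` (`ν = 41/250`),
`∫_{Δ₂(w)} 𝟙[ν ≤ vᵢ < 1/2]/(v₀v₁) = ∫_{Δ₂(w)} 𝟙[ν < v₀ < w − ν]/(v₀v₁)`. [folklore] -/
theorem K3_eq_window_lower_0164 {w : ℝ} (hw2 : w ≤ 1 / 2 + 41 / 250) :
    sliceIntegral 2 w (fun v => if (∀ i, (41 / 250 : ℝ) ≤ v i) ∧ (∀ i, v i < 1 / 2) then 1 / (v 0 * v 1) else 0) =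
      sliceIntegral 2 w (fun v => if (41 / 250 : ℝ) < v 0 ∧ v 0 < w - 41 / 250 then 1 / (v 0 * v 1) else 0) := by
  rw [sliceIntegral_succ_eq, sliceIntegral_succ_eq]
  refine integral_congr_ae ?_
  have hnull : volume ({u : Fin 1 → ℝ | u 0 = 41 / 250} ∪ {u : Fin 1 → ℝ | u 0 = w - 41 / 250}) = 0 :=
    measure_union_null (volume_coord_eq_zero_fin_one _) (volume_coord_eq_zero_fin_one _)
  refine (measure_mono_null (fun u hu => ?_) hnull : volume {u : Fin 1 → ℝ | ¬ _} = 0)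
  -- off the two hyperplanes the integrands agree
  by_contra hmem
  simp only [Set.mem_union, Set.mem_setOf_eq, not_or] at hmem
  apply hu
  change sliceIntegrand 1 w _ u = sliceIntegrand 1 w _ u
  unfold sliceIntegrand
  simp only [Fin.sum_univ_one, snoc_fin_one_eq, Fin.forall_fin_two, Matrix.cons_val_zero, Matrix.cons_val_one]
  by_cases hc : (∀ i : Fin 1, 0 < u i) ∧ u 0 < w
  · rw [if_pos hc, if_pos hc]
    have hiff : (((41 / 250 : ℝ) ≤ u 0 ∧ (41 / 250 : ℝ) ≤ w - u 0) ∧ (u 0 < 1 / 2 ∧ w - u 0 < 1 / 2)) ↔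
        ((41 / 250 : ℝ) < u 0 ∧ u 0 < w - 41 / 250) := by
      constructor
      · rintro ⟨⟨h1, h2⟩, -⟩
        exact ⟨lt_of_le_of_ne h1 (Ne.symm hmem.1), lt_of_le_of_ne (by linarith) hmem.2⟩
      · rintro ⟨h1, h2⟩
        exact ⟨⟨h1.le, by linarith⟩, ⟨by linarith, by linarith⟩⟩
    simp only [hiff]
  · rw [if_neg hc, if_neg hc]

/-- **The kernel `K(w) = ∫_{Δ₂(w)} 𝟙[ν ≤ vᵢ < 1/2]/(v₀v₁)` in closed form** on `w ∈ (1/2, 1]` (`ν = 41/250`):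
`(log((1/2)/(w−1/2)) − log((w−1/2)/(1/2)))/w` for `w ≥ 1/2 + ν` and
`(log((w−ν)/ν) − log(ν/(w−ν)))/w` for `1/2 < w < 1/2 + ν` (Ford–Maynard: `= (2/w)·log(w/max(ν, w−1/2) − 1)`).
[cite: FordMaynard2024PrimeSieves, §8 ("F₄(α) = log(α/max(ν,α−1/2) − 1)")] -/
theorem K3_closed_form_0164 {w : ℝ} (hw1 : 1 / 2 < w) (hw2 : w ≤ 1) :
    sliceIntegral 2 w (fun v => if (∀ i, (41 / 250 : ℝ) ≤ v i) ∧ (∀ i, v i < 1 / 2) then 1 / (v 0 * v 1) else 0) =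
      if 1 / 2 + 41 / 250 ≤ w then
        (Real.log ((1 / 2) / (w - 1 / 2)) - Real.log ((w - 1 / 2) / (w - (w - 1 / 2)))) / w
      else (Real.log ((w - 41 / 250) / (w - (w - 41 / 250))) - Real.log ((41 / 250) / (w - 41 / 250))) / w := by
  split_ifs with h
  · exact K3_eq_log_upper_0164 h hw2
  · push Not at h
    rw [K3_eq_window_lower_0164 h.le, K3_eq_log_lower_0164 (by linarith)]

/-- **`J₃` as an explicit one-dimensional logarithmic integral**:
`J₃ = ∫_{t ∈ (0,1]} 𝟙[ν ≤ t < 1/2] · Φ(t)/t dt` with `Φ(t) = K(1 − t)` given by `K3_closed_form_0164`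
(`ν = 41/250`; numerically `J₃ = 2.57053`, Ford–Maynard's `I₃ = −J₃/3`).
[cite: FordMaynard2024PrimeSieves, §8 ("I₃ = −2∫_ν^{1/3} log((1−x)/max(x,1/2−x) − 1)/(x(1−x)) dx")] -/
theorem J3_eq_integral_log_0164 :
    sliceIntegral 3 1 (fun v : Fin 3 → ℝ =>
      if (∀ i, (41 / 250 : ℝ) ≤ v i) ∧ (∀ i, v i < 1 / 2) then 1 / (v 0 * v 1 * v 2) else 0) =
      ∫ t in Ioc (0 : ℝ) 1, (if (41 / 250 : ℝ) ≤ t ∧ t < 1 / 2 then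
        1 / t * (if 1 / 2 + 41 / 250 ≤ 1 - t then
          (Real.log ((1 / 2) / (1 - t - 1 / 2)) - Real.log ((1 - t - 1 / 2) / (1 - t - (1 - t - 1 / 2)))) / (1 - t)
        else (Real.log ((1 - t - 41 / 250) / (1 - t - (1 - t - 41 / 250))) -
          Real.log ((41 / 250) / (1 - t - 41 / 250))) / (1 - t)) else 0) := by
  rw [J3_eq_integral_kernel_0164]
  refine setIntegral_congr_fun measurableSet_Ioc fun t ht => ?_
  by_cases hc : (41 / 250 : ℝ) ≤ t ∧ t < 1 / 2
  · simp only [if_pos hc]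
    rw [K3_closed_form_0164 (by linarith [hc.2]) (by linarith [hc.1])]
  · simp only [if_neg hc]

end Summit.Parity.GeneralizedHardyLittlewood.FordMaynardNoSieveConst0164NegWitness0164

end
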